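import Mathlib.GroupTheory.SpecificGroups.Alternating
import Mathlib.LinearAlgebra.Matrix.SpecialLinearGroup
import Mathlib.LinearAlgebra.Matrix.GeneralLinearGroup.Defs
import Literature.RepresentationTheory.FiniteGroups.RepresentationRing
import Literature.RepresentationTheory.FiniteGroups.TaketaTheorem
import HarnessLib

/-!
# Booker's criterion for certifying Artin's conjecture up to a height: almost monomial groups
# (Exp. Math. 15 (2006) §2: Definition 2.1, Propositions 2.2–2.3, the counterexamples)

Topic `Literature/NumberTheory/LFunctions`; namespace `Literature.NumberTheory.LFunctions`,
grouping namespace `Booker2006` (the notion is Booker's ad hoc group-theoretic criterion for his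
`L`-function computations — "A criterion for verifying Artin's conjecture", §2 — and is filed with
the certified-computation literature it serves; it is stated in the vocabulary of
`Literature/RepresentationTheory/FiniteGroups`: `IsIrrChar`/`irrChars` (CharacterDegrees),
`virtChars` = `R(G)` (RepresentationRing), `classInner` = `⟨·,·⟩` and `indClassFun H λ` = `Ind_H^G λ`
(InducedClassFunction / BrauerInduction), `IsMGroup` = monomial group (TaketaTheorem)). Typed for
the parity-realchar cell (D-0088 (4) literature-typing layer, row «Booker 2006 (Artin, Turing, class
numbers)»), statement-first (D-0064): definitions with bodies, published results as named facts
(D-0014), no discharge attempted.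

Source: A. R. Booker, *Artin's conjecture, Turing's method, and the Riemann hypothesis*,
Experiment. Math. **15** (2006) 385–407 [Booker2006], §2 pp. 387–391 (journal pdf held as
`paper:url-702ab4eacdaa` pp. 4–7; arXiv:math/0507502 = `paper:arxiv-math_0507502`, there
Definition 1, Propositions 2–3). Context (§2, p. 388): Brauer's theorem writes `L(s, ρ) = N(s)/D(s)`
with `N, D` Artin `L`-functions of sums of monomial representations; the Heilbronn virtual characters
`θ_{s₀} = Σ_ρ ord_{s=s₀} L(s, ρ) · Tr ρ` satisfy `⟨θ_{s₀}, σ⟩ = ord_{s=s₀} L(s, σ) ≥ 0` for all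
monomial `σ` ((2–2); the tree's `Heilbronn.artinOrder*` files), so certified net zero counts near a
zero of `ζ_K` decide holomorphy of every `L(s, ρ)` there as soon as (2–4) holds: "`Tr ρ ≠ χ₁ + χ₂`
for virtual characters `χᵢ ≠ 0` with `⟨χᵢ, σ⟩ ≥ 0` for all monomial `σ`".

## Contents

* `Booker2006.IsDMPositive χ` — "`⟨χ, σ⟩ ≥ 0` for all monomial `σ`" ("dual-monomial positive",
  p. 389), for a function `χ : G → ℂ` (applied to virtual characters): for every subgroup `H` and
  every degree-one character `λ : H → ℂˣ`, `0 ≤ ⟨χ, Ind_H^G λ⟩` in Mathlib's order on `ℂ` (real and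
  non-negative; for `χ ∈ R(G)` the product is an integer). Monomial `σ` = induced from a
  1-dimensional representation of a subgroup (§1.1 p. 385); testing single induced characters is
  the same as testing their sums.
* `Booker2006.IsAlmostMonomial G` — **Definition 2.1** (p. 389), verbatim.
* `Booker2006.IsRHCheckable G` — the weaker condition (2–6) (p. 391; arXiv (9)):
  "`Tr ρ ≠ χ₁ + 2χ₂` for virtual characters `χᵢ ≠ 0` with `⟨χᵢ, σ⟩ ≥ 0` for all monomial `σ`", under
  which the zero-count certification of `ζ_K` still goes through around a generic zero.
* Named facts: `booker2006_proposition22` (**Prop. 2.2**: quotients, and products with a monomial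
  group), `booker2006_proposition23` (**Prop. 2.3**, first clause: `SL₂(𝔽₃)`, `A₅`, `S₅` are almost
  monomial — a GAP computation), `booker2006_notAlmostMonomial` (p. 390: "`GL₂(𝔽₃)` and `SL₂(𝔽₅)`"
  are not almost monomial — GAP).

NOT typed (gap recorded, no silent weakening): the central-point condition (2–5)
(`Σ_{ρ self-dual, Λ(1−s,ρ) = −Λ(s,ρ)} Tr ρ ≠ χ₁ + 2χ₂ …`) and hence the second clause "and satisfy
(2–5)" of Prop. 2.3 — it quantifies over which irreducible Artin `L`-functions of the group have odd
functional equation ("we try all possible combinations of `ρ` having odd functional equation", p. 390),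
i.e. over root numbers of Artin representations, not over the group alone; the informal remarks "any
monomial group is almost monomial" (p. 389, "easy to see": in an M-group a DM-positive virtual
character has non-negative Fourier coefficients, and orthonormality forces `{χ₁, χ₂} = {0, Tr ρ}`) and
"we may still check … for `SL₂(𝔽₅)` extensions" (p. 391, i.e. `IsRHCheckable SL₂(𝔽₅)`) are recorded
here but not filed as facts; §§3–6 (explicit formula, Turing's method — see
`CertifiedDirichletLTuringMethod.lean` —, rigorous FFT evaluation, the `S₅`/`A₅` numerics to height
`100`).

`lean search` (2026-08-26): `IsMGroup`, `IsMonomialSum`, `virtChars`, `classInner`, `indClassFun`,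
`IsIrrChar` exist and are reused; "almost monomial" / "DM-positive" occur nowhere in the tree or Mathlib.

## References

* [Booker2006] A. R. Booker, *Artin's conjecture, Turing's method, and the Riemann hypothesis*,
  Experiment. Math. 15 (2006), no. 4, 385–407: §2 Definition 2.1, Propositions 2.2–2.3, (2–4)–(2–6),
  pp. 388–391.
* [SerreLinearRepresentations1977] J.-P. Serre, *Linear Representations of Finite Groups*, GTM 42,
  §7.1–7.2, §9.1 (monomial representations, `Ind`, `R(G)`).
* [Isaacs1976] I. M. Isaacs, *Character Theory of Finite Groups*, Def. 5.10 (M-groups).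
-/

noncomputable section

open scoped ComplexOrder

namespace Literature.NumberTheory.LFunctions

namespace Booker2006

open Literature.RepresentationTheory.FiniteGroups

variable {G : Type} [Group G] [Fintype G]

/-- **DM-positive** ("dual-monomial positive", Booker p. 389): `χ : G → ℂ` has `⟨χ, σ⟩ ≥ 0` for
every monomial character `σ = Ind_H^G λ`, `λ` a degree-one character of a subgroup `H` ("monomial
representations, those induced from a 1-dimensional representation of a subgroup", §1.1); here
`⟨·,·⟩ = classInner` (Serre's `(1/|G|) Σ φ(s)ψ(s⁻¹)`, which on virtual characters is the usual inner
product) and `0 ≤ z` in `ℂ` means `z` is real and non-negative. Testing the generators `Ind_H^G λ` of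
the monomial monoid is equivalent to testing all its elements (additivity of `⟨χ, ·⟩`).
[cite: Booker2006, §2 (2–4) and Definition 2.1, p. 389] -/
def IsDMPositive (χ : G → ℂ) : Prop :=
  ∀ (H : Subgroup G) (θ : H →* ℂˣ), 0 ≤ classInner χ (indClassFun H fun h => (θ h : ℂ))

/-- **Booker 2006, Definition 2.1 (p. 389), as printed:** "A finite group `G` is *almost monomial* if
for each irreducible representation `ρ`, if `Tr ρ = χ₁ + χ₂` for virtual characters `χᵢ` such that
`⟨χᵢ, σ⟩ ≥ 0` for all monomial `σ`, then either `χ₁ = 0` or `χ₂ = 0`." (`Tr ρ` ranges over the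
irreducible characters `irrChars G`; virtual characters = `virtChars G` = `R(G)`.)
[cite: Booker2006, §2 Definition 2.1, p. 389] -/
def IsAlmostMonomial (G : Type) [Group G] [Fintype G] : Prop :=
  ∀ ρ ∈ irrChars G, ∀ χ₁ ∈ virtChars G, ∀ χ₂ ∈ virtChars G,
    IsDMPositive χ₁ → IsDMPositive χ₂ → ρ = χ₁ + χ₂ → χ₁ = 0 ∨ χ₂ = 0

/-- **Booker 2006, condition (2–6) (p. 391; arXiv (9))**, the weakening of Definition 2.1 under
which Booker's zero-count certification of `ζ_K` (as opposed to that of the individual `L(s, ρ)`)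
still goes through around a generic zero: for each irreducible `ρ`, "`Tr ρ ≠ χ₁ + 2χ₂` for virtual
characters `χᵢ ≠ 0` with `⟨χᵢ, σ⟩ ≥ 0` for all monomial `σ`", "a weaker condition than almost
monomiality". [cite: Booker2006, §2 (2–6), p. 391] -/
def IsRHCheckable (G : Type) [Group G] [Fintype G] : Prop :=
  ∀ ρ ∈ irrChars G, ∀ χ₁ ∈ virtChars G, ∀ χ₂ ∈ virtChars G,
    IsDMPositive χ₁ → IsDMPositive χ₂ → ρ = χ₁ + 2 • χ₂ → χ₁ = 0 ∨ χ₂ = 0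

end Booker2006

open Literature.RepresentationTheory.FiniteGroups Booker2006

/-- **Booker 2006, Proposition 2.2 (p. 389; proof p. 390), as printed:** "If `G` is almost monomial,
then so are quotients of `G` and products `G × H` for any monomial group `H`." (Monomial group =
M-group, the tree's `IsMGroup`: every irreducible character is `Ind_H^G λ` with `λ` of degree one.)
Proof in the source: lift DM-positive decompositions along `G → G/K` using Frobenius reciprocity,
resp. contract against the irreducible characters of `H`. (The binder `[Fintype (G ⧸ K)]` only
supplies the finite-type structure of the quotient, which always exists.) Not discharged here (size M).
[cite: Booker2006, §2 Proposition 2.2, pp. 389–390] -/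
def booker2006_proposition22 : Prop :=
  (∀ (G : Type) [Group G] [Fintype G] (K : Subgroup G) [K.Normal] [Fintype (G ⧸ K)],
      IsAlmostMonomial G → IsAlmostMonomial (G ⧸ K)) ∧
    ∀ (G H : Type) [Group G] [Fintype G] [Group H] [Fintype H],
      IsAlmostMonomial G → IsMGroup H → IsAlmostMonomial (G × H)

/-- **Booker 2006, Proposition 2.3 (p. 390), first clause, as printed:** "The groups `SL₂(𝔽₃)`,
`A₅`, and `S₅` are almost monomial [and satisfy (2–5)]." ("These are shown with the aid of the
computer algebra system GAP": enumerate the monomial characters, solve the integral system (2–7).)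
The clause "and satisfy (2–5)" (the central-point condition, which refers to root numbers of Artin
`L`-functions) is NOT typed — see the module docstring. Not discharged here (a finite computation
over the character tables; size M–L in the kernel). [cite: Booker2006, §2 Proposition 2.3, p. 390] -/
def booker2006_proposition23 : Prop :=
  IsAlmostMonomial (Matrix.SpecialLinearGroup (Fin 2) (ZMod 3)) ∧
    IsAlmostMonomial (alternatingGroup (Fin 5)) ∧ IsAlmostMonomial (Equiv.Perm (Fin 5))

/-- **Booker 2006, §2 p. 390, as printed:** "one might hope that all groups are almost monomial.
That is not the case, as the counterexamples `GL₂(𝔽₃)` and `SL₂(𝔽₅)` show" (for `SL₂(𝔽₅)` and its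
`6`-dimensional `ρ`, (2–4) fails with `χ₁` one of three explicit virtual characters built from the
induced representations listed in (2–8), p. 391). A GAP computation; not discharged here.
[cite: Booker2006, §2 p. 390 (after Proposition 2.3) and (2–8) p. 391] -/
def booker2006_notAlmostMonomial : Prop :=
  ¬ IsAlmostMonomial (GL (Fin 2) (ZMod 3)) ∧ ¬ IsAlmostMonomial (Matrix.SpecialLinearGroup (Fin 2) (ZMod 5))

end Literature.NumberTheory.LFunctions

end
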